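import Summits.KontsevichZagierPeriods.KontsevichZagierPeriods.Theses.LatticeLefschetz
import Summits.KontsevichZagierPeriods.KontsevichZagierPeriods.Theorems.IsogenyCertificatesAlgebraicModuliRealPeriodCell
import Summits.KontsevichZagierPeriods.KontsevichZagierPeriods.Theorems.IsogenyCertificatesAlgebraicModuliRealPeriodCellPeriodRep
import Summits.KontsevichZagierPeriods.KontsevichZagierPeriods.Theorems.IsogenyCertificatesXMapKernelStubHuberWustholzSplitting
import Literature.NumberTheory.EllipticCurves.RealLatticePeriodDiscrProofs
import Literature.NumberTheory.EllipticCurves.UniformizationUniqueProofs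
import Literature.NumberTheory.EllipticCurves.RealPeriod
import Literature.NumberTheory.Transcendental.KZCalculus

/-!
# Crux `TwistTransfer` (stmt-KontsevichZagierPeriods-18159, route `LatticeLefschetz`) — line `alg_cell_corollary`: the four stubs K/A/V/T PROVED + the composition `TwistTransfer_of` (support file; the one-line closing theorem is the prover's)

Strategist line (planner-cstrat s1, 2026-08-17), registered ADDITIVELY next to the planner's birth
skeleton (`bc/TwistTransfer_birth_pub.lean`: IsogenyBranch → PiecewiseBranchMove → UnboundedReductionAlg,
three opaque `…Sig` abbreviations, never crux-written, skelvet BLOCKED) — that skeleton is NOT touched.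

**Idea (lens: transfer — the solved sibling's version of exactly this step).** The sibling crux
`IsogenyCertificates.AlgebraicModuliRealPeriodCell` (stmt-KontsevichZagierPeriods-18265) is PROVED in the tree
(`AlgRealPeriodCell.AlgebraicModuliRealPeriodCell_of`, Theorems/IsogenyCertificatesAlgebraicModuliRealPeriodCell.lean):
Conjecture 1 in kernel form on the sector `[{x³+αx+β>0}, a/√(x³+αx+β)]` with REAL-ALGEBRAIC `α, β, a`.
`TwistTransfer` is its two-term instance once three elementary facts are in place:

* K `stub_inclusionIndex` — a real lattice inclusion `μΛ₁ ⊆ Λ₂` (`μ > 0`, both lattices real) has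
  `μΩ₀(Λ₁) = kΩ₀(Λ₂)` with `k ∈ ℕ_{>0}` (`Λ₂ ∩ ℝ = ℤΩ₀(Λ₂)`: `PeriodPair.IsReal.exists_eq_int_mul`);
* A `stub_multiplierAlgebraic` — the multiplier of a lattice inclusion between lattices with integral
  invariants is algebraic (`XMapKernelStubs.HuberWustholzSplitting.isAlgebraic_of_mul_mem_lattice`: the
  over-lattice `μ⁻¹Λ₂ ⊇ Λ₁` has algebraic invariants `μ⁴g₂`, `μ⁶g₃`);
* V `stub_sectorValue` — a representation `[{P>0}, c/√P]`, `P = x³+Ax+B`, `4A³+27B² < 0`, has value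
  `c·2Ω₀(Λ)` for EVERY period pair `Λ` with `g₂ = −4A`, `g₃ = −4B` (`PeriodRep.value_eq`,
  `PeriodRep.exists_periodPair`, `uniformization_unique_holds`, `numRealComponents_of_Δ_pos`);
* T `stub_algTwoTermKernel` — TRANSFER: two representations of the real-algebraic sector with equal
  values are KZ-equivalent (`AlgebraicModuliRealPeriodCell_of` on `[s₁] − [s₂]`, `eval = 0`).

`TwistTransfer_of` (PROVED below, no sorry) concludes the route declaration BY NAME: K gives `k`, A gives
`μ ∈ ℚ̄`, V computes both values, `(qμ/k)·2Ω₀(Λ₁) = (q/k)·2·kΩ₀(Λ₂) = q·2Ω₀(Λ₂)`, and T with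
`a₁ = qμ/k ∈ ℚ̄` (ℚ · ℚ̄ · ℚ), `a₂ = q`, `αᵢ = Aᵢ`, `βᵢ = Bᵢ` gives `KZ.Equivalent s₁ s₂`.

Why it dodges the birth line's stuck point (its `why it might fail`: "branch semialgebraicity, finite
fibres and the k-piece dissection at real division points must be redone over ℝ_alg; a piece image
missing more than a null set breaks rule 2"): no branch, fibre or dissection is formed here at all — the
ℝ_alg x-map transfer was done once and for all inside the sibling's landed stubs
(`Transfer.stub_algXMapTransfer`, `DatumOfRealMult.stub_algDatumOfRealMult`), behind the interface
`AlgebraicModuliRealPeriodCell`.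

Disproof used: none exists for this crux (`ledger crux ls`: no Disproof.lean; negatives index: no entry on
TwistTransfer); the refuter's birth attack (rattack 12:58Z) found the hypotheses jointly satisfiable and the
values consistent — honoured: K uses `IsReal` + `0 < μ` exactly where the attack said they sign-normalise `k`.

References: Kontsevich–Zagier, *Periods* (2001) §1.2; Silverman, *AEC* (2009) VI.4.1(b), VI.5.3, C.16;
Lawden, *Elliptic Functions and Applications* (1989) §6.15; Huber–Wüstholz (2022) Thm. 15.3.
-/

noncomputable section

open Set MeasureTheory
open Literature.NumberTheory.Transcendental

namespace Summit.KontsevichZagierPeriods.LatticeLefschetz.TwistTransferAlgCell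

open Summit.KontsevichZagierPeriods.KontsevichZagierPeriods.Theses.LatticeLefschetz (TwistTransfer)
open Summit.KontsevichZagierPeriods.IsogenyCertificates.AlgRealPeriodCell
  (AlgebraicModuliRealPeriodCell_of)
open Summit.KontsevichZagierPeriods.IsogenyCertificates.AlgRealPeriodCell.PeriodRep
  (value_eq exists_periodPair curve_Δ)
open Summit.KontsevichZagierPeriods.IsogenyCertificates.XMapKernelStubs.HuberWustholzSplitting
  (isAlgebraic_of_mul_mem_lattice)
open Summit.KontsevichZagierPeriods.KontsevichZagierPeriods.Theses.IsogenyCertificates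
  (AlgebraicModuliRealPeriodCell)

/-- **K — index of a real lattice inclusion.** For real lattices `Λ₁, Λ₂` and a real `μ > 0` with
`μΛ₁ ⊆ Λ₂`: `μ·Ω₀(Λ₁) = k·Ω₀(Λ₂)` for a positive integer `k` — `μΩ₀(Λ₁)` is a positive real period of
`Λ₂` and `Λ₂ ∩ ℝ = ℤ·Ω₀(Λ₂)` (`PeriodPair.IsReal.exists_eq_int_mul`, Lawden §6.15). [cite: Lawden1989, §6.15] -/
theorem stub_inclusionIndex : ∀ (L₁ L₂ : PeriodPair), L₁.IsReal → L₂.IsReal → ∀ (μ : ℝ), 0 < μ → (∀ z ∈ L₁.lattice, (μ : ℂ) * z ∈ L₂.lattice) → ∃ k : ℕ, 0 < k ∧ μ * L₁.minRealPeriod = (k : ℝ) * L₂.minRealPeriod := by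
  intro L₁ L₂ h₁ h₂ μ hμ hincl
  have hmem : ((μ * L₁.minRealPeriod : ℝ) : ℂ) ∈ L₂.lattice := by
    push_cast
    exact hincl _ h₁.minRealPeriod_mem_lattice
  obtain ⟨k, hk⟩ := h₂.exists_eq_int_mul hmem
  have hpos : 0 < μ * L₁.minRealPeriod := mul_pos hμ h₁.minRealPeriod_pos
  have h2pos := h₂.minRealPeriod_pos
  have hk0 : (0 : ℝ) < k := by
    rw [hk] at hpos
    exact pos_of_mul_pos_left hpos h2pos.le
  have hk0' : (0 : ℤ) < k := by exact_mod_cast hk0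
  obtain ⟨n, rfl⟩ := Int.eq_ofNat_of_zero_le hk0'.le
  refine ⟨n, by exact_mod_cast hk0', ?_⟩
  rw [hk]
  push_cast
  ring

/-- **A — the multiplier of a lattice inclusion between integral cubics is algebraic.** If
`g₂, g₃` of `Λ₁` and `Λ₂` are `−4Aᵢ, −4Bᵢ` with `Aᵢ, Bᵢ ∈ ℤ`, `μ ≠ 0` real and `μΛ₁ ⊆ Λ₂`, then
`μ ∈ ℚ̄` (`isAlgebraic_of_mul_mem_lattice`: the over-lattice `μ⁻¹Λ₂ ⊇ Λ₁` has algebraic invariants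
`μ⁴g₂(Λ₂)`, `μ⁶g₃(Λ₂)`, not both zero; Silverman AEC VI.4.1(b)). [cite: SilvermanAEC2009, Thm. VI.4.1] -/
theorem stub_multiplierAlgebraic : ∀ (A₁ B₁ A₂ B₂ : ℤ) (L₁ L₂ : PeriodPair), L₁.g₂ = -4 * (A₁ : ℂ) → L₁.g₃ = -4 * (B₁ : ℂ) → L₂.g₂ = -4 * (A₂ : ℂ) → L₂.g₃ = -4 * (B₂ : ℂ) → ∀ (μ : ℝ), μ ≠ 0 → (∀ z ∈ L₁.lattice, (μ : ℂ) * z ∈ L₂.lattice) → IsAlgebraic ℚ μ := by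
  intro A₁ B₁ A₂ B₂ L₁ L₂ h12 h13 h22 h23 μ hμ hincl
  have hinj : Function.Injective (algebraMap ℝ ℂ) := (algebraMap ℝ ℂ).injective
  have hint : ∀ n : ℤ, IsAlgebraic ℚ (-4 * (n : ℂ)) := fun n => by
    have h := isAlgebraic_int (R := ℚ) (A := ℂ) (-4 * n)
    push_cast at h
    exact h
  have hμC : (μ : ℂ) ≠ 0 := Complex.ofReal_ne_zero.mpr hμ
  have halg : IsAlgebraic ℚ (μ : ℂ) :=
    isAlgebraic_of_mul_mem_lattice (by rw [h12]; exact hint A₁) (by rw [h13]; exact hint B₁)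
      (by rw [h22]; exact hint A₂) (by rw [h23]; exact hint B₂) hμC hincl
  exact (isAlgebraic_algebraMap_iff hinj).mp halg

/-- **V — the value of a representation of the sector.** For `4A³ + 27B² < 0` and ANY period pair
`Λ` with `g₂ = −4A`, `g₃ = −4B`, a representation with domain `{x³+Ax+B > 0}` and integrand
`c/√(x³+Ax+B)` on it has value `c · 2Ω₀(Λ)` (two real components: `PeriodRep.value_eq`,
`PeriodRep.exists_periodPair`, `uniformization_unique_holds`, `numRealComponents_of_Δ_pos`;
Silverman AEC C.16, Lawden (6.12.18)). [cite: SilvermanAEC2009, C.16] -/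
theorem stub_sectorValue : ∀ (A B : ℤ), 4 * A ^ 3 + 27 * B ^ 2 < 0 → ∀ (L : PeriodPair), L.g₂ = -4 * (A : ℂ) → L.g₃ = -4 * (B : ℂ) → ∀ (c : ℝ) (s : Literature.NumberTheory.Transcendental.KZ.IntegralRep 1), s.domain = {x | 0 < x 0 ^ 3 + (A : ℝ) * x 0 + (B : ℝ)} → Set.EqOn s.integrand (fun x => c / Real.sqrt (x 0 ^ 3 + (A : ℝ) * x 0 + (B : ℝ))) s.domain → s.value = c * (2 * L.minRealPeriod) := by
  intro A B hΔ L h2 h3 c s hd hi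
  have hΔR : 4 * (A : ℝ) ^ 3 + 27 * (B : ℝ) ^ 2 < 0 := by exact_mod_cast hΔ
  have hΔ' : 4 * (A : ℝ) ^ 3 + 27 * (B : ℝ) ^ 2 ≠ 0 := hΔR.ne
  rw [value_eq s hd hi]
  obtain ⟨L', h2', h3', -, hint⟩ := exists_periodPair hΔ'
  rw [hint]
  have hlat : L'.lattice = L.lattice :=
    PeriodPair.uniformization_unique_holds L' L (by rw [h2', h2]; push_cast; ring)
      (by rw [h3', h3]; push_cast; ring)
  have hcomp : (⟨0, 0, 0, (A : ℝ), (B : ℝ)⟩ : WeierstrassCurve ℝ).numRealComponents = 2 := by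
    apply WeierstrassCurve.numRealComponents_of_Δ_pos
    rw [curve_Δ]
    linarith
  rw [hcomp, PeriodPair.minRealPeriod_def, PeriodPair.minRealPeriod_def, hlat]
  push_cast
  ring

/-- **T — TRANSFER: the two-term instance of the sibling's PROVED cell.** Two representations
`[{x³+αᵢx+βᵢ > 0}, aᵢ/√(x³+αᵢx+βᵢ)]` with real-algebraic `αᵢ, βᵢ, aᵢ` (nonsingular) and equal values
are KZ-equivalent: `AlgRealPeriodCell.AlgebraicModuliRealPeriodCell_of` (stmt-18265, closed proved;
transcendence input Huber–Wüstholz Thm. 15.3, certificates the real-algebraic x-map transfer) applied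
to `[s₁] − [s₂]`, whose `eval` is `s₁.value − s₂.value = 0`. [cite: HuberWustholz2022, Thm. 15.3] -/
theorem stub_algTwoTermKernel : ∀ (α₁ β₁ a₁ α₂ β₂ a₂ : ℝ), IsAlgebraic ℚ α₁ → IsAlgebraic ℚ β₁ → IsAlgebraic ℚ a₁ → IsAlgebraic ℚ α₂ → IsAlgebraic ℚ β₂ → IsAlgebraic ℚ a₂ → 4 * α₁ ^ 3 + 27 * β₁ ^ 2 ≠ 0 → 4 * α₂ ^ 3 + 27 * β₂ ^ 2 ≠ 0 → ∀ (s₁ s₂ : Literature.NumberTheory.Transcendental.KZ.IntegralRep 1), s₁.domain = {x | 0 < x 0 ^ 3 + α₁ * x 0 + β₁} → Set.EqOn s₁.integrand (fun x => a₁ / Real.sqrt (x 0 ^ 3 + α₁ * x 0 + β₁)) s₁.domain → s₂.domain = {x | 0 < x 0 ^ 3 + α₂ * x 0 + β₂} → Set.EqOn s₂.integrand (fun x => a₂ / Real.sqrt (x 0 ^ 3 + α₂ * x 0 + β₂)) s₂.domain → s₁.value = s₂.value → Literature.NumberTheory.Transcendental.KZ.Equivalent s₁ s₂ := by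
  intro α₁ β₁ a₁ α₂ β₂ a₂ hα₁ hβ₁ ha₁ hα₂ hβ₂ ha₂ hΔ₁ hΔ₂ s₁ s₂ hd₁ hi₁ hd₂ hi₂ hv
  have h := AlgebraicModuliRealPeriodCell_of
  unfold AlgebraicModuliRealPeriodCell at h
  unfold KZ.Equivalent
  refine h _ (sub_mem (AddSubgroup.subset_closure ?_) (AddSubgroup.subset_closure ?_)) ?_
  · exact ⟨α₁, β₁, a₁, s₁, hα₁, hβ₁, ha₁, hΔ₁, hd₁, hi₁, rfl⟩
  · exact ⟨α₂, β₂, a₂, s₂, hα₂, hβ₂, ha₂, hΔ₂, hd₂, hi₂, rfl⟩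
  · simp [KZ.eval_of, hv]

/-- **The crux `TwistTransfer`, by name, from the four stubs** (real proof, no sorry): K gives `k`,
A gives `μ ∈ ℚ̄`, V computes the two values and `μΩ₀(Λ₁) = kΩ₀(Λ₂)` makes them equal, T concludes
with `a₁ = qμ/k`, `a₂ = q` (both algebraic), `αᵢ = Aᵢ`, `βᵢ = Bᵢ`. [cite: KontsevichZagier2001, §1.2] -/
theorem TwistTransfer_of
    (hK : ∀ (L₁ L₂ : PeriodPair), L₁.IsReal → L₂.IsReal → ∀ (μ : ℝ), 0 < μ → (∀ z ∈ L₁.lattice, (μ : ℂ) * z ∈ L₂.lattice) → ∃ k : ℕ, 0 < k ∧ μ * L₁.minRealPeriod = (k : ℝ) * L₂.minRealPeriod)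
    (hA : ∀ (A₁ B₁ A₂ B₂ : ℤ) (L₁ L₂ : PeriodPair), L₁.g₂ = -4 * (A₁ : ℂ) → L₁.g₃ = -4 * (B₁ : ℂ) → L₂.g₂ = -4 * (A₂ : ℂ) → L₂.g₃ = -4 * (B₂ : ℂ) → ∀ (μ : ℝ), μ ≠ 0 → (∀ z ∈ L₁.lattice, (μ : ℂ) * z ∈ L₂.lattice) → IsAlgebraic ℚ μ)
    (hV : ∀ (A B : ℤ), 4 * A ^ 3 + 27 * B ^ 2 < 0 → ∀ (L : PeriodPair), L.g₂ = -4 * (A : ℂ) → L.g₃ = -4 * (B : ℂ) → ∀ (c : ℝ) (s : Literature.NumberTheory.Transcendental.KZ.IntegralRep 1), s.domain = {x | 0 < x 0 ^ 3 + (A : ℝ) * x 0 + (B : ℝ)} → Set.EqOn s.integrand (fun x => c / Real.sqrt (x 0 ^ 3 + (A : ℝ) * x 0 + (B : ℝ))) s.domain → s.value = c * (2 * L.minRealPeriod))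
    (hT : ∀ (α₁ β₁ a₁ α₂ β₂ a₂ : ℝ), IsAlgebraic ℚ α₁ → IsAlgebraic ℚ β₁ → IsAlgebraic ℚ a₁ → IsAlgebraic ℚ α₂ → IsAlgebraic ℚ β₂ → IsAlgebraic ℚ a₂ → 4 * α₁ ^ 3 + 27 * β₁ ^ 2 ≠ 0 → 4 * α₂ ^ 3 + 27 * β₂ ^ 2 ≠ 0 → ∀ (s₁ s₂ : Literature.NumberTheory.Transcendental.KZ.IntegralRep 1), s₁.domain = {x | 0 < x 0 ^ 3 + α₁ * x 0 + β₁} → Set.EqOn s₁.integrand (fun x => a₁ / Real.sqrt (x 0 ^ 3 + α₁ * x 0 + β₁)) s₁.domain → s₂.domain = {x | 0 < x 0 ^ 3 + α₂ * x 0 + β₂} → Set.EqOn s₂.integrand (fun x => a₂ / Real.sqrt (x 0 ^ 3 + α₂ * x 0 + β₂)) s₂.domain → s₁.value = s₂.value → Literature.NumberTheory.Transcendental.KZ.Equivalent s₁ s₂) :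
    TwistTransfer := by
  intro A₁ B₁ A₂ B₂ hΔ₁ hΔ₂ L₁ L₂ hR₁ hR₂ h12 h13 h22 h23 μ hμ hincl
  obtain ⟨k, hk, hμk⟩ := hK L₁ L₂ hR₁ hR₂ μ hμ hincl
  have halg : IsAlgebraic ℚ μ := hA A₁ B₁ A₂ B₂ L₁ L₂ h12 h13 h22 h23 μ hμ.ne' hincl
  refine ⟨k, hk, hμk, halg, ?_⟩
  intro q hq s₁ s₂ hd₁ hi₁ hd₂ hi₂
  have hΔ₁' : 4 * (A₁ : ℝ) ^ 3 + 27 * (B₁ : ℝ) ^ 2 ≠ 0 := by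
    have : 4 * (A₁ : ℝ) ^ 3 + 27 * (B₁ : ℝ) ^ 2 < 0 := by exact_mod_cast hΔ₁
    exact this.ne
  have hΔ₂' : 4 * (A₂ : ℝ) ^ 3 + 27 * (B₂ : ℝ) ^ 2 ≠ 0 := by
    have : 4 * (A₂ : ℝ) ^ 3 + 27 * (B₂ : ℝ) ^ 2 < 0 := by exact_mod_cast hΔ₂
    exact this.ne
  have hv₁ := hV A₁ B₁ hΔ₁ L₁ h12 h13 ((q : ℝ) * μ / (k : ℝ)) s₁ hd₁ hi₁
  have hv₂ := hV A₂ B₂ hΔ₂ L₂ h22 h23 (q : ℝ) s₂ hd₂ hi₂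
  have hqa : IsAlgebraic ℚ ((q : ℝ) * μ / (k : ℝ)) := by
    rw [div_eq_mul_inv]
    exact ((isAlgebraic_rat ℚ q).mul halg).mul (isAlgebraic_nat (k : ℕ)).inv
  refine hT (A₁ : ℝ) (B₁ : ℝ) ((q : ℝ) * μ / (k : ℝ)) (A₂ : ℝ) (B₂ : ℝ) (q : ℝ)
    (isAlgebraic_int A₁) (isAlgebraic_int B₁) hqa (isAlgebraic_int A₂) (isAlgebraic_int B₂)
    (isAlgebraic_rat ℚ q) hΔ₁' hΔ₂' s₁ s₂ hd₁ hi₁ hd₂ hi₂ ?_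
  rw [hv₁, hv₂]
  have hk' : (k : ℝ) ≠ 0 := by exact_mod_cast hk.ne'
  rw [show (q : ℝ) * μ / (k : ℝ) * (2 * L₁.minRealPeriod) = (q : ℝ) * 2 * (μ * L₁.minRealPeriod) / (k : ℝ) by ring, hμk]
  field_simp

/-! ### Closing the crux
The item `stmt-KontsevichZagierPeriods-18159` closes by the ONE line
`theorem twistTransfer : TwistTransfer := TwistTransfer_of stub_inclusionIndex stub_multiplierAlgebraic stub_sectorValue stub_algTwoTermKernel`
(kernel-checked in the strategist's evidence file `line-alg_cell_corollary_closed.lean`, rc 0 / 0 sorry /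
audit proof-of-item closed=true, 2026-08-17) — left to the item's prover (one-writer rule: planners file
support, provers close items). -/

end Summit.KontsevichZagierPeriods.LatticeLefschetz.TwistTransferAlgCell

end
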